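import Summits.QuantumFields.YangMills.Theorems.BalabanUVNodesN08AtRecord13CoPHLaneFamily
import Summits.QuantumFields.YangMills.Theorems.BalabanUVNodesN08AlphaProfileSUEnd
import Literature.MathematicalPhysics.QuantumFieldTheory.Balaban1983to89.B10LeafUnpinnedRecord5C

/-!
# BalabanUVNodes ∕ N08 AT THE v1.7 STAGE-13 RECORD THROUGH THE RE-BOUND [B10] LAYER AT dag-n08-d's CHOSEN EXTERNAL INPUTS `XeOf` — THE (α) CLAUSE WITH ITS IN-EDGE SIDE EMPTY, KNIT INTO
# THE RECORD — v1.7 `CoPH` EDITION OF RECORD 13 (director-ym LINE №183 RULING H1ʰ ∕ №186 (α) ∕ №187; FINDING №9 = node00-def-T LOCATED-9 «the v1.6 residual 𝐓-weight slot `Stage13RParams.Zr p`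
is run-indexed but HISTORY-BLIND, while print's ζ(Ω^c_{k+1}) ([Balaban1988Convergent] p.267 L15–20, (3.23) p.270) reads the term's whole history (Ω_j, Λ_j)»): def-T FILE 27 `Node00/Record13CoPH`
(p537939 ✓ 2668afee4a5b: `structure Stage13HParams extends Stage13RParams` + history-indexed fields `Zh p n Ω Λ : TkResidualW F N (FluctV N) p.K` (level-indexed, read AT THE WHOLE HISTORY `θ.zhAt p s = θ.Zh p n s.Ω s.Λ`)
and `Phih` (history-indexed smearing functions of the residual §2 data, C2 fold №187), guard `ZhUnity`, weights `WtOfRecord₁₃H θ p s`, provisos `Stage13HParams.Provisos₁₃CoPH` (Core rows +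
`zhLaws ∕ zhLocal`), view `toStage5₁₃CoPH`, datum `datumOfRecord₁₃CoPH`, record `IsRecordOfRecord₁₃CCoPH` + faces; THE DOOR `Stage13HParams.ofHistoryBlind θ := ⟨θ, fun p _ _ _ => θ.Zr p, fun p _ _ _ => (θ.Rz p.K).phi⟩`
+ `rfl` ∕ `Iff.rfl` faces + dot-forms `Stage13RParams.ZrUnity.ofHistoryBlind ∕ ….Provisos₁₃(Sep)CoPR.ofHistoryBlind`) and FILE 28T `Node00/Record13SepCoPH` (p539169 ✓ df011462f50f: `Provisos₁₃SepCoPH`, `datumOfRecord₁₃SepCoPH`,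
`IsRecordOfRecord₁₃CSepCoPH` + `.toCoPH`); dag-n10-d's H carrier leaves `Node00/Record13CarriersCoPH` (p539476 ✓ 944d848ee41f: §0 THE H-PIN ALGEBRA `Stage13HParams.onBase ∕ rebindX ∕ pin<G>` (structure updates
keeping `Zh ∕ Phih`), `toStage5₁₃CoPH_rebindX ∕ _pin<G>`, `Provisos₁₃CoPH.rebindX ∕ .pin<G>`, `datumOfRecord₁₃CoPH_rebindX ∕ _pin<G>`, `isRecordOfRecord₁₃CCoPH_rebindX ∕ _pinB10_of_eq`, `exists_world_…_rebindX`,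
`guard_rebindX_iff`, H views `view₁₃CoPHB10YZW ∕ …B8B10YZW` + `_eq` + `_leaves`, §6 door-commute faces) and `…/Record13CarriersSepCoPH` (p540513 ✓ 81f7bc100561: `Provisos₁₃SepCoPH.pin<G>`, `datumOfRecord₁₃SepCoPH_pin<G>`,
`isRecordOfRecord₁₃CSepCoPH_pinB10_of_eq`).  Token map T₇ (plan IMPACT-183 + AMENDMENT (α), def-T KEYMAP v1.7, dag-lead WORDS): «the v1.6 names with `CoPR ↦ CoPH`, binders `Stage13RParams ↦ Stage13HParams`, `ZrUnity ↦ ZhUnity`, rows `zrLaws ∕ zrLocal ↦ zhLaws ∕ zhLocal`, `WtOfRecord₁₃R θ p ↦ (s ↦ WtOfRecord₁₃H θ p s)`».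
# THIS FILE = the T₇ image of `BalabanUVNodesN08AtRecord13CoPRLaneXeOf` (p536334; the CoPR image of the knit p522919): N08's lane conjunct at an `IsRecordOfRecord₁₃CCoPH` record from `θ`'s
# provisos ∕ admissibility ∕ guard and the cluster-expansion DATA SCHEMA at `XeOf` ALONE (generic gauge group `G` with a direction `X ∈ 𝔤 ∖ 0` and the size condition `4π ≤ C68`; for
# `SU(M)`, `M ≥ 2`, at the bumped constants `bump68 𝔠₀` with NO structural hypothesis) — dag-n08-d g5's record-free END forms `BalabanUVNodesN08AlphaProfileRecord.b10_main_upC_XeOf` (F9)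
# ∕ `…ProfileGroupSU` (F10: `suDir`) ∕ `…ProfileConsts` (F11: `four_pi_le_regMin_bump68`) ∕ `…ProfileSUEnd` (F12, p514827) composed BY NAME with dag-n10-d's H re-binding face
# `Node00.exists_world_isRecordOfRecord₁₃CCoPH_rebindX` and def-T's C-binding identity `Node00.upOfRecord₅C_eq` (Track A, DAG node N08 [Balaban1985UV3] CMP **102** (1985) 255, Thm 1 p. 257 (compact reading) + Thm 2 p. 272; R134 fan-out seat `pub-ymgap-dag-n08-c` g17, strategy s2
«knit at the record of record», trigger (t31) = FINDING №9 ∕ №174 (3) «pens port their OWN files»; 2026-08-27)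

WHY THIS FILE.  p536334 keys on `Stage13RParams ∕ Provisos₁₃CoPR ∕ IsRecordOfRecord₁₃CCoPR` and re-binds with n10-d's R-level `rebindX`; at v1.7 the re-binding is dag-n10-d's H-level
`Stage13HParams.rebindX` and the view `toStage5₁₃CoPH` (`Stage13HParams.toStage5₁₃CoPH_rebindX`, `rfl`), so the knit is re-typed here under T₇.  The `rfl` glue «Stage-3 substitutions
commute with re-binding the B10 group» and «the C-binding of record over a tower-run residual carrier IS `ofPrintedAllXPNC ((carriers₃ σ₃ Xc).withTowerRuns10 T) (Y P) (Z P) (V P) (W P)`»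
is CITED from `B10LeafUnpinnedRecord5C` §4 (`carriers₃_withTowerRuns10`, `upOfRecord₅C_eq_of_towerRuns` — `Stage5Params`-generic, edition-free).  §3 is stated at the H-LIFT of K0a's
all-numerics maker (departure (ii′) below; (iii) does not arise in this file).
HONEST DEPARTURES FROM A PURE TOKEN IMAGE (generator `tools/coph_n08_gen.py`; every other statement SHAPE verbatim under T₇, proofs re-checked):
(i) the 𝐑-bundle `WOfRecord₁₃` (12a; reads no 𝐓-slot, NOT re-issued) is fed the base `θ.toStage13Params`, as at ⁶; (ii′) every WITNESS-LINE theorem is stated at the H-LIFT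
`⟨⟨θ₀, Zr⟩, Zh, Phih⟩ : Stage13HParams F N` of node00-def-K0a's v1.5 maker `θ₀` (`theta13LiveOfRecord ∕ theta13LiveOfNumerics … ∕ theta13LiveOfFamily₂ …`, θ-level, background-free)
by an ARBITRARY run-indexed residual family `Zr` AND ARBITRARY history-indexed fields `Zh ∕ Phih` (FILE 27's field tuple; so K0a's history-blind ⁷ witnesses `ofHistoryBlind ⟨θ₀, Zr₀⟩`
AND any future VALUE pin of `Zh` instantiate them by `exact`); admissibility and `SlotsNondegenerate₁₃` of the lift ARE K0a's faces of `θ₀` through the base (definitional), while the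
guard half `ZhUnity` is DISPLAYED as `hZ` in the `N = 2` forms; (iii) the two ⁶ forms `…_at_ZrOfRecord₁₃` become `…_at_ofHistoryBlind_ZrOfRecord₁₃`, stated AT THE DOOR
`Stage13HParams.ofHistoryBlind F 2 ⟨θL, ZrOfRecord₁₃ F 2 θL⟩` (= `ofHistoryBlind (Stage13RParams.ofCured F 2 θL)` of K0a's `Record13SepCoPRInhabitedOfSepCoP` §2, by `rfl`): there the v1.7
guard `ZhUnity` IS the cured R-lift's `ZrUnity` through def-T's `Stage13RParams.ZrUnity.ofHistoryBlind`, hence HYPOTHESIS-FREE by FILE 17 `finsum_ζ0_ZrOfRecord₁₃` (every generation, every run).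

WHAT IS PROVED (kernel bookkeeping BY NAME; 0 `def`, 0 `sorry`).
* §1 generic `G`: ★ `exists_world₁₃CCoPH_laneXeOf_b10_main_of_data` — from `θ`, `h : θ.Provisos₁₃CoPH F N`, admissibility, the lane letters `(𝔊, 𝔠, hC, X, hX, hX0, X₀, hstd, w, Bk)` at
  block size `θ.L`, expansion ∕ auxiliary data `𝔖 ∕ 𝔄 ∕ coef` and THE DATA SCHEMA AT `XeOf` on the window: a world (any window height `γw`, block size `θ.L`) that IS a ₁₃CCoPH record
  of `datumOfRecord₁₃CoPH F N θ h`, bound over the H view of `θ.rebindX (lane family at XeOf)`, with `Dag.B10_main (leavesP w P)` at every run; ★ `exists_guarded_record₁₃CCoPH_laneXeOf_b10_main_of_data`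
  — N08's conjunct shape of a C-keyed `NodesAtSomeRecord13`, witnessed AT `θ`; ★ `…_of_inhabited13CoPH` — «C-keyed inhabitation `∃ θ, Provisos₁₃CoPH ∧ guard ∧ Admissible` + AT EVERY
  ODD `L > 1` lane letters with the DATA schema at `XeOf` ⟹ N08's conjunct» (the (α) programme's displayed inputs in place of the slot socket of `…N08AtRecord13CoPH` §2 — no in-edge face).
* §2 `G = SU(M)`, `M ≥ 2`, at `bump68 𝔠₀` (direction `suDir`, size condition a theorem): ★★ `exists_world₁₃CCoPH_laneXeOf_b10_main_of_data_su_bump`,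
  ★★ `exists_guarded_record₁₃CCoPH_laneXeOf_b10_main_of_data_su_bump`, ★★ `…_of_inhabited13CoPH_su_bump` (+ `_two`: the record's own group `N = 2` on the 𝕋⁴ side AND the lane group `SU(2)`).
* §3 ★★ `…_at_theta13LiveOfNumerics_of_data_su_bump` — at the H-lift `⟨⟨θL, Zr⟩, Zh, Phih⟩` of K0a's all-numerics member (block size `F.L`), provisos OPAQUE, `hZ` displayed, lane `SU(2)`.
HONEST FRAMING — PLEASE READ.  The re-bound [B10] layer here is THE LANE'S constructed family at n08-d's chosen inputs `XeOf` (standard averaging, the lane's exact Haar-compatibility field; `XeOf` is n08-d's DEFINITION — a choice of minimisers — not data of print), NOT print's run family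
of record (`runsB10OfRecord`, the `pinB10` layer) — hence NOT the slot `Node00.PrintedUV3V N θ.L` and NOT a re-pointing of S1; whether N08's COUNT may be read there is the chair's
species word (seam E6′, R451 ∕ R454).  Count-neutral re-keying of a LANDED storey to the re-issued record (new file; p536334 stays as the ⁶ sibling).  The DATA schema `RunDataRows`
(the [B10] §§2–3 cluster expansion at the lane's run objects — class II of the n08-b census = the object gap in data form), the in-edge hypotheses where displayed, the provisos,
admissibility, the guard and every window inequality are DISPLAYED hypotheses; nothing of Bałaban's asserted; a re-key is not progress; K0 ∕ K1 neither proved nor assumed; N08 NOT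
discharged; one finite four-torus per run at fixed `ε`, the lane's d = 3 tori inside the record; nothing continuum ∕ ℝ⁴ ∕ OS ∕ mass gap ∕ Clay.  0 `sorry`, 0 `def`, standard axioms.
Sources: [Balaban1985UV3] Thm 1 p.257 (compact reading), Thm 2 p.272, (41)–(42) p.266, (44) p.267, (67)–(68) p.273, p.256 L15–18; [Balaban1985Variational] Thm 1 p.279;
[Balaban1985Averaging] Prop. 2 (54) p.26; [Balaban1989LargeFieldII] Thm 1 + (0.1) pp.355–356; [Balaban1988Convergent] p.244, (1.11) p.248, (2.18) p.257, p.267, (3.16)–(3.23) pp.268–270;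
[Balaban1987RG1] Thm 1 p.255; [Balaban1984PropagatorsII] pp.223–250 (the Stage-3 carriers).
-/

noncomputable section

namespace Summit.QuantumFields.YangMills.BalabanUVNodes.N08AtRecord13CoPHLaneXeOf

open MeasureTheory
open scoped BigOperators Matrix Matrix.Norms.L2Operator
open Literature.MathematicalPhysics.QuantumFieldTheory.Balaban1983to89
open Literature.MathematicalPhysics.QuantumFieldTheory.Balaban1983to89.B10
open Literature.MathematicalPhysics.QuantumFieldTheory.Balaban1983to89.B10SectCExpansion (TermSizes)
open Literature.MathematicalPhysics.QuantumFieldTheory.Balaban1985CMP102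
open Literature.MathematicalPhysics.QuantumFieldTheory.Balaban1985CMP102.Setting
open Literature.MathematicalPhysics.QuantumFieldTheory.Balaban1983to89.T4Continuum (T4Family FiniteEpsData)
open Literature.MathematicalPhysics.QuantumFieldTheory.Balaban1983to89.DagBinding (leavesP WorldP PrintedCarriersR PrintedCarriers9X PrintedCarriers11 PrintedCarriers14R
  PrintedCarriers15)
open Literature.MathematicalPhysics.QuantumFieldTheory.Balaban1983to89.B10CompactBinding (ofPrintedAllXPNC)
open Literature.MathematicalPhysics.QuantumFieldTheory.Balaban1983to89.Node00
open Summit.QuantumFields.Balaban3D.Carriers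
open Summit.QuantumFields.Balaban3D.Proofs.Inputs
open Summit.QuantumFields.Balaban3D.Proofs.Primitives (AlphaConsts)
open Summit.QuantumFields.Balaban3D.Proofs.GroupModelLieC (lieC)
open Summit.QuantumFields.Balaban3D.Proofs.UVStability3DInputs
open Summit.QuantumFields.Balaban3D.Proofs.FamilyLE (ScalesLE)
open Summit.QuantumFields.YangMills.Theorems.BalabanUVNodesN08AlphaClassI
open Summit.QuantumFields.YangMills.Theorems.BalabanUVNodesN08AlphaLoop28
open Summit.QuantumFields.YangMills.Theorems.BalabanUVNodesN08AlphaThreeFaces (regMin)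
open Summit.QuantumFields.YangMills.Theorems.BalabanUVNodesN08AlphaProfileThreshold
open Summit.QuantumFields.YangMills.Theorems.BalabanUVNodesN08AlphaProfileRecord
open Summit.QuantumFields.YangMills.Theorems.BalabanUVNodesN08AlphaProfileGroupSU
open Summit.QuantumFields.YangMills.Theorems.BalabanUVNodesN08AlphaProfileConsts
open Summit.QuantumFields.YangMills.BalabanUVNodes.N08AtRecord13CoPH

variable {F : T4Family} {N : ℕ} [NeZero N]

/-! ## §1 GENERIC GAUGE GROUP: N08 AT THE CoPH RECORD FROM THE DATA SCHEMA AT `XeOf` ALONE -/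

section Generic
variable {G : Type} [GaugeGroup G] [MeasurableSpace G] [HaarData G] (𝔊 : GroupModel G)

/-- **★ A ₁₃CCoPH RECORD OF `datumOfRecord₁₃CoPH F N θ h` BOUND OVER THE CoPH VIEW OF THE LANE-RE-BOUND PARAMETERS AT `XeOf`, CARRYING N08 AT EVERY RUN, FROM THE DATA SCHEMA AT
`XeOf` ALONE** (any window `γw`, block size `θ.L`): lane letters `𝔠` with `4π ≤ (regMin 𝔠).C68`, a direction `X ∈ 𝔤 ∖ 0`, base inputs `X₀` with the standard averaging, `w`, `Bk`;
expansion data `𝔖`, auxiliary data `𝔄`, sizes `coef`; DISPLAYED: `RunDataRows` at `XeOf …` on the window `g²ε₀ ≤ (min γ_N08^d 1)²`.  World by n10-d's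
`exists_world_isRecordOfRecord₁₃CCoPH_rebindX`; N08 by n08-d's `b10_main_upC_XeOf` at the `ofPrintedAllXPNC` word the record's world unfolds to (`B10LeafUnpinnedRecord5C.upOfRecord₅C_eq_of_towerRuns`) — NO in-edge hypothesis. [cite: Balaban1985UV3, Thm 1 p.257 (compact reading) + Thm 2 p.272 + (41)–(42) p.266 + (67)–(68) p.273; Balaban1985Variational, Thm 1 p.279; Balaban1985Averaging, Prop. 2 (54) p.26; Balaban1989LargeFieldII, Thm 1 + (0.1) pp.355–356 (bookkeeping)] -/
theorem exists_world₁₃CCoPH_laneXeOf_b10_main_of_data (θ : Stage13HParams F N) (h : θ.Provisos₁₃CoPH F N) (hθ : θ.Admissible F N)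
    (𝔠 : AlphaConsts θ.L 𝔊.N) (hC : 4 * Real.pi ≤ (regMin 𝔠).C68) {X : Matrix (Fin 𝔊.N) (Fin 𝔊.N) ℂ} (hX : X ∈ 𝔊.lie) (hX0 : X ≠ 0)
    (X₀ : ∀ S : Scales θ.L, ExternalInputs S G) (hstd : ∀ S : Scales θ.L, (X₀ S).av = AveragingRT.stdAvg S.P G) (w : ℝ)
    (Bk : ∀ (S : Scales θ.L) (k : ℕ), Hist S.P k → Set (PBond S.P k))
    (𝔖 : ∀ (S : Scales θ.L) (k : ℕ), StepSeries S G ↥(lieC 𝔊) (nblkOf S 𝔠.lane.carrier k) k)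
    (𝔄 : ∀ S : Scales θ.L, AlphaData 𝔊 𝔠 (XeOf 𝔊 𝔠 X₀ hstd w hX hX0 hC Bk S) (𝔖 S))
    (coef : ∀ (S : Scales θ.L) (k : ℕ), Hist S.P (k + 1) → GaugeField S.P (k + 1) G → (j : ℕ) → TermSizes (oldGeom S.P k j))
    (hD : ∀ S : Scales θ.L, S.g ^ 2 * S.ε₀ ≤ (min (gammaN08d 𝔠) 1) ^ 2 →
      RunDataRows 𝔊 𝔠 (XeOf 𝔊 𝔠 X₀ hstd w hX hX0 hC Bk S) (𝔖 S) (𝔄 S) (sizesOf 𝔊 𝔠 (XeOf 𝔊 𝔠 X₀ hstd w hX hX0 hC Bk S) (coef S)))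
    {γw : ℝ} (hγw : 0 < γw ∧ γw ≤ θ.γ) :
    ∃ w' : WorldP, IsRecordOfRecord₁₃CCoPH F N (datumOfRecord₁₃CoPH F N θ h) w' ∧ w'.γ = γw ∧ w'.L = (θ.L : ℝ) ∧
      (∀ P, w'.up P = upOfRecord₅C F N ((θ.rebindX F N fun P => (θ.res.X P).withTowerRuns10
        fun S : ScalesLE θ.L ((min (gammaN08d 𝔠) 1) ^ 2) => towerOf 𝔠.lane (XeOf 𝔊 𝔠 X₀ hstd w hX hX0 hC Bk S.1) (𝔖 S.1)).toStage5₁₃CoPH F N) P) ∧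
      ∀ P : B12.RunParams, Dag.B10_main (leavesP w' P) := by
  obtain ⟨w', hR, hγ, hL, hup⟩ := exists_world_isRecordOfRecord₁₃CCoPH_rebindX F N θ h hθ
    (fun P => (θ.res.X P).withTowerRuns10
      fun S : ScalesLE θ.L ((min (gammaN08d 𝔠) 1) ^ 2) => towerOf 𝔠.lane (XeOf 𝔊 𝔠 X₀ hstd w hX hX0 hC Bk S.1) (𝔖 S.1)) hγw
  refine ⟨w', hR, hγ, hL, hup, fun P => ?_⟩
  -- the record's world IS n08-d's `ofPrintedAllXPNC` word (n10-d's `toStage5₁₃CoPH_rebindX` + `B10LeafUnpinnedRecord5C.upOfRecord₅C_eq_of_towerRuns`, both `rfl`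
  -- bookkeeping), so n08-d's record-free closer applies at it
  have hup' := (hup P).trans (((congrArg (fun σ => upOfRecord₅C F N σ P) (Stage13HParams.toStage5₁₃CoPH_rebindX F N θ _))).trans
    (B10LeafUnpinnedRecord5C.upOfRecord₅C_eq_of_towerRuns _ P (θ.res.X P) _ rfl))
  exact b10_main_upC_XeOf 𝔊 𝔠 X₀ hstd w hX hX0 hC Bk 𝔖 𝔄 coef _ _ _ _ _ w' P hD hup'

/-- **★ N08's CONJUNCT SHAPE OF A CORE-KEYED `NodesAtSomeRecord13`, WITNESSED AT `θ`, FROM THE DATA SCHEMA AT `XeOf` ALONE** (plus `θ`'s Core provisos, admissibility and guard;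
the presenting re-bound parameter is inside the ∃ of `IsRecordOfRecord₁₃CCoPH`). [cite: Balaban1985UV3, Thm 1 p.257 (compact reading) + Thm 2 p.272; Balaban1989LargeFieldII, Thm 1 + (0.1) pp.355–356; Balaban1988Convergent, (3.16)–(3.22) pp.268–269 (bookkeeping)] -/
theorem exists_guarded_record₁₃CCoPH_laneXeOf_b10_main_of_data (θ : Stage13HParams F N) (h : θ.Provisos₁₃CoPH F N) (hθ : θ.Admissible F N)
    (hG : θ.ZhUnity F N ∧ θ.SlotsNondegenerate₁₃ F N)
    (𝔠 : AlphaConsts θ.L 𝔊.N) (hC : 4 * Real.pi ≤ (regMin 𝔠).C68) {X : Matrix (Fin 𝔊.N) (Fin 𝔊.N) ℂ} (hX : X ∈ 𝔊.lie) (hX0 : X ≠ 0)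
    (X₀ : ∀ S : Scales θ.L, ExternalInputs S G) (hstd : ∀ S : Scales θ.L, (X₀ S).av = AveragingRT.stdAvg S.P G) (w : ℝ)
    (Bk : ∀ (S : Scales θ.L) (k : ℕ), Hist S.P k → Set (PBond S.P k))
    (𝔖 : ∀ (S : Scales θ.L) (k : ℕ), StepSeries S G ↥(lieC 𝔊) (nblkOf S 𝔠.lane.carrier k) k)
    (𝔄 : ∀ S : Scales θ.L, AlphaData 𝔊 𝔠 (XeOf 𝔊 𝔠 X₀ hstd w hX hX0 hC Bk S) (𝔖 S))
    (coef : ∀ (S : Scales θ.L) (k : ℕ), Hist S.P (k + 1) → GaugeField S.P (k + 1) G → (j : ℕ) → TermSizes (oldGeom S.P k j))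
    (hD : ∀ S : Scales θ.L, S.g ^ 2 * S.ε₀ ≤ (min (gammaN08d 𝔠) 1) ^ 2 →
      RunDataRows 𝔊 𝔠 (XeOf 𝔊 𝔠 X₀ hstd w hX hX0 hC Bk S) (𝔖 S) (𝔄 S) (sizesOf 𝔊 𝔠 (XeOf 𝔊 𝔠 X₀ hstd w hX hX0 hC Bk S) (coef S))) :
    ∃ (θ' : Stage13HParams F N) (h' : θ'.Provisos₁₃CoPH F N) (w' : WorldP), (θ'.ZhUnity F N ∧ θ'.SlotsNondegenerate₁₃ F N) ∧ θ'.Admissible F N ∧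
      IsRecordOfRecord₁₃CCoPH F N (datumOfRecord₁₃CoPH F N θ' h') w' ∧ ∀ P : B12.RunParams, Dag.B10_main (leavesP w' P) := by
  obtain ⟨w', hR, -, -, -, hN⟩ := exists_world₁₃CCoPH_laneXeOf_b10_main_of_data 𝔊 θ h hθ 𝔠 hC hX hX0 X₀ hstd w Bk 𝔖 𝔄 coef hD
    ⟨hθ.toStage9.gamma_pos, le_rfl⟩
  exact ⟨θ, h, w', hG, hθ, hR, hN⟩

/-- **★ «A CORE-KEYED INHABITATION ⟹ N08's CONJUNCT OF A CORE-KEYED STAGE-13 NODES-∃» FROM THE DATA SCHEMA AT `XeOf` ALONE, generic `N` and `G`**: from `∃ θ, Provisos₁₃CoPH ∧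
(ZhUnity ∧ SlotsNondegenerate₁₃) ∧ Admissible` at `F` (HYPOTHESIS `hI`) and, AT EVERY ODD BLOCK SIZE `L > 1`, lane letters `(𝔠, hC, X, hX, hX0, X₀, hstd, w, Bk, 𝔖, 𝔄, coef)` with
the DATA SCHEMA at `XeOf` on the window (HYPOTHESIS `hlane` — the (α) programme's displayed inputs, NO in-edge face) ⟹ N08's conjunct.  NOT the stub, NOT a discharge; the
[B10] layer is the lane's, not print's (module docstring). [cite: Balaban1985UV3, Thm 1 p.257 (compact reading) + Thm 2 p.272 + p.256 L15–18; Balaban1989LargeFieldII, Thm 1 + (0.1) pp.355–356 (bookkeeping)] -/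
theorem exists_guarded_record₁₃CCoPH_laneXeOf_b10_main_of_inhabited13CoPH
    (hI : ∃ θ : Stage13HParams F N, θ.Provisos₁₃CoPH F N ∧ (θ.ZhUnity F N ∧ θ.SlotsNondegenerate₁₃ F N) ∧ θ.Admissible F N)
    (hlane : ∀ L : ℕ, Odd L → 1 < L →
      ∃ (𝔠 : AlphaConsts L 𝔊.N) (hC : 4 * Real.pi ≤ (regMin 𝔠).C68) (X : Matrix (Fin 𝔊.N) (Fin 𝔊.N) ℂ) (hX : X ∈ 𝔊.lie) (hX0 : X ≠ 0)
        (X₀ : ∀ S : Scales L, ExternalInputs S G) (hstd : ∀ S : Scales L, (X₀ S).av = AveragingRT.stdAvg S.P G) (w : ℝ)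
        (Bk : ∀ (S : Scales L) (k : ℕ), Hist S.P k → Set (PBond S.P k))
        (𝔖 : ∀ (S : Scales L) (k : ℕ), StepSeries S G ↥(lieC 𝔊) (nblkOf S 𝔠.lane.carrier k) k)
        (𝔄 : ∀ S : Scales L, AlphaData 𝔊 𝔠 (XeOf 𝔊 𝔠 X₀ hstd w hX hX0 hC Bk S) (𝔖 S))
        (coef : ∀ (S : Scales L) (k : ℕ), Hist S.P (k + 1) → GaugeField S.P (k + 1) G → (j : ℕ) → TermSizes (oldGeom S.P k j)),
        ∀ S : Scales L, S.g ^ 2 * S.ε₀ ≤ (min (gammaN08d 𝔠) 1) ^ 2 →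
          RunDataRows 𝔊 𝔠 (XeOf 𝔊 𝔠 X₀ hstd w hX hX0 hC Bk S) (𝔖 S) (𝔄 S) (sizesOf 𝔊 𝔠 (XeOf 𝔊 𝔠 X₀ hstd w hX hX0 hC Bk S) (coef S))) :
    ∃ (θ : Stage13HParams F N) (h : θ.Provisos₁₃CoPH F N) (w' : WorldP), (θ.ZhUnity F N ∧ θ.SlotsNondegenerate₁₃ F N) ∧ θ.Admissible F N ∧
      IsRecordOfRecord₁₃CCoPH F N (datumOfRecord₁₃CoPH F N θ h) w' ∧ ∀ P : B12.RunParams, Dag.B10_main (leavesP w' P) := by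
  obtain ⟨θ, h, hG, hθ⟩ := hI
  obtain ⟨𝔠, hC, X, hX, hX0, X₀, hstd, w, Bk, 𝔖, 𝔄, coef, hD⟩ := hlane θ.L θ.hL.1 θ.hL.2
  exact exists_guarded_record₁₃CCoPH_laneXeOf_b10_main_of_data 𝔊 θ h hθ hG 𝔠 hC hX hX0 X₀ hstd w Bk 𝔖 𝔄 coef hD

end Generic

/-! ## §2 `G = SU(N)`, `N ≥ 2`, AT THE BUMPED CONSTANTS `bump68 𝔠₀` — direction `suDir`, size condition a theorem (`four_pi_le_regMin_bump68`): NO structural hypothesis -/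

section SU
variable {M : ℕ} [NeZero M]

/-- **★★ `SU(M)`, `M ≥ 2`: A ₁₃CCoPH RECORD OF `datumOfRecord₁₃CoPH F N θ h` BOUND OVER THE CoPH VIEW OF THE LANE-RE-BOUND PARAMETERS AT `XeOf` (lane group `SU(M)`, constants `bump68 𝔠₀`,
direction `suDir`), CARRYING N08 AT EVERY RUN — from base inputs `X₀` (standard averaging), `w`, `Bk`, data `𝔖 ∕ 𝔄 ∕ coef` and THE DATA SCHEMA AT `XeOf` ALONE** (any window `γw`,
block size `θ.L`). [cite: Balaban1985UV3, Thm 1 p.257 (compact reading) + Thm 2 p.272 + (41)–(42) p.266 + (67)–(68) p.273; Balaban1985Variational, Thm 1 p.279; Balaban1989LargeFieldII, Thm 1 + (0.1) pp.355–356 (bookkeeping)] -/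
theorem exists_world₁₃CCoPH_laneXeOf_b10_main_of_data_su_bump (hM : 2 ≤ M) (θ : Stage13HParams F N) (h : θ.Provisos₁₃CoPH F N) (hθ : θ.Admissible F N)
    (𝔠₀ : AlphaConsts θ.L (suGroupModel M).N)
    (X₀ : ∀ S : Scales θ.L, ExternalInputs S (Matrix.specialUnitaryGroup (Fin M) ℂ))
    (hstd : ∀ S : Scales θ.L, (X₀ S).av = AveragingRT.stdAvg S.P (Matrix.specialUnitaryGroup (Fin M) ℂ)) (w : ℝ)
    (Bk : ∀ (S : Scales θ.L) (k : ℕ), Hist S.P k → Set (PBond S.P k))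
    (𝔖 : ∀ (S : Scales θ.L) (k : ℕ), StepSeries S (Matrix.specialUnitaryGroup (Fin M) ℂ) ↥(lieC (suGroupModel M)) (nblkOf S (bump68 𝔠₀).lane.carrier k) k)
    (𝔄 : ∀ S : Scales θ.L, AlphaData (suGroupModel M) (bump68 𝔠₀)
      (XeOf (suGroupModel M) (bump68 𝔠₀) X₀ hstd w (suDir_mem_su hM) (suDir_ne_zero hM) (four_pi_le_regMin_bump68 𝔠₀) Bk S) (𝔖 S))
    (coef : ∀ (S : Scales θ.L) (k : ℕ), Hist S.P (k + 1) → GaugeField S.P (k + 1) (Matrix.specialUnitaryGroup (Fin M) ℂ) → (j : ℕ) → TermSizes (oldGeom S.P k j))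
    (hD : ∀ S : Scales θ.L, S.g ^ 2 * S.ε₀ ≤ (min (gammaN08d (bump68 𝔠₀)) 1) ^ 2 →
      RunDataRows (suGroupModel M) (bump68 𝔠₀)
        (XeOf (suGroupModel M) (bump68 𝔠₀) X₀ hstd w (suDir_mem_su hM) (suDir_ne_zero hM) (four_pi_le_regMin_bump68 𝔠₀) Bk S) (𝔖 S) (𝔄 S)
        (sizesOf (suGroupModel M) (bump68 𝔠₀)
          (XeOf (suGroupModel M) (bump68 𝔠₀) X₀ hstd w (suDir_mem_su hM) (suDir_ne_zero hM) (four_pi_le_regMin_bump68 𝔠₀) Bk S) (coef S)))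
    {γw : ℝ} (hγw : 0 < γw ∧ γw ≤ θ.γ) :
    ∃ w' : WorldP, IsRecordOfRecord₁₃CCoPH F N (datumOfRecord₁₃CoPH F N θ h) w' ∧ w'.γ = γw ∧ w'.L = (θ.L : ℝ) ∧
      (∀ P, w'.up P = upOfRecord₅C F N ((θ.rebindX F N fun P => (θ.res.X P).withTowerRuns10
        fun S : ScalesLE θ.L ((min (gammaN08d (bump68 𝔠₀)) 1) ^ 2) => towerOf (bump68 𝔠₀).lane
          (XeOf (suGroupModel M) (bump68 𝔠₀) X₀ hstd w (suDir_mem_su hM) (suDir_ne_zero hM) (four_pi_le_regMin_bump68 𝔠₀) Bk S.1) (𝔖 S.1)).toStage5₁₃CoPH F N) P) ∧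
      ∀ P : B12.RunParams, Dag.B10_main (leavesP w' P) :=
  exists_world₁₃CCoPH_laneXeOf_b10_main_of_data (suGroupModel M) θ h hθ (bump68 𝔠₀) (four_pi_le_regMin_bump68 𝔠₀) (suDir_mem_su hM) (suDir_ne_zero hM)
    X₀ hstd w Bk 𝔖 𝔄 coef hD hγw

/-- **★★ `SU(M)`, `M ≥ 2`: N08's CONJUNCT SHAPE OF A CORE-KEYED `NodesAtSomeRecord13`, WITNESSED AT `θ`, FROM THE DATA SCHEMA AT `XeOf` ALONE** (plus Core provisos, admissibility,
guard; constants `bump68 𝔠₀`, direction `suDir` — no structural hypothesis). [cite: Balaban1985UV3, Thm 1 p.257 (compact reading) + Thm 2 p.272; Balaban1989LargeFieldII, Thm 1 + (0.1) pp.355–356; Balaban1988Convergent, (3.16)–(3.22) pp.268–269 (bookkeeping)] -/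
theorem exists_guarded_record₁₃CCoPH_laneXeOf_b10_main_of_data_su_bump (hM : 2 ≤ M) (θ : Stage13HParams F N) (h : θ.Provisos₁₃CoPH F N) (hθ : θ.Admissible F N)
    (hG : θ.ZhUnity F N ∧ θ.SlotsNondegenerate₁₃ F N) (𝔠₀ : AlphaConsts θ.L (suGroupModel M).N)
    (X₀ : ∀ S : Scales θ.L, ExternalInputs S (Matrix.specialUnitaryGroup (Fin M) ℂ))
    (hstd : ∀ S : Scales θ.L, (X₀ S).av = AveragingRT.stdAvg S.P (Matrix.specialUnitaryGroup (Fin M) ℂ)) (w : ℝ)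
    (Bk : ∀ (S : Scales θ.L) (k : ℕ), Hist S.P k → Set (PBond S.P k))
    (𝔖 : ∀ (S : Scales θ.L) (k : ℕ), StepSeries S (Matrix.specialUnitaryGroup (Fin M) ℂ) ↥(lieC (suGroupModel M)) (nblkOf S (bump68 𝔠₀).lane.carrier k) k)
    (𝔄 : ∀ S : Scales θ.L, AlphaData (suGroupModel M) (bump68 𝔠₀)
      (XeOf (suGroupModel M) (bump68 𝔠₀) X₀ hstd w (suDir_mem_su hM) (suDir_ne_zero hM) (four_pi_le_regMin_bump68 𝔠₀) Bk S) (𝔖 S))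
    (coef : ∀ (S : Scales θ.L) (k : ℕ), Hist S.P (k + 1) → GaugeField S.P (k + 1) (Matrix.specialUnitaryGroup (Fin M) ℂ) → (j : ℕ) → TermSizes (oldGeom S.P k j))
    (hD : ∀ S : Scales θ.L, S.g ^ 2 * S.ε₀ ≤ (min (gammaN08d (bump68 𝔠₀)) 1) ^ 2 →
      RunDataRows (suGroupModel M) (bump68 𝔠₀)
        (XeOf (suGroupModel M) (bump68 𝔠₀) X₀ hstd w (suDir_mem_su hM) (suDir_ne_zero hM) (four_pi_le_regMin_bump68 𝔠₀) Bk S) (𝔖 S) (𝔄 S)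
        (sizesOf (suGroupModel M) (bump68 𝔠₀)
          (XeOf (suGroupModel M) (bump68 𝔠₀) X₀ hstd w (suDir_mem_su hM) (suDir_ne_zero hM) (four_pi_le_regMin_bump68 𝔠₀) Bk S) (coef S))) :
    ∃ (θ' : Stage13HParams F N) (h' : θ'.Provisos₁₃CoPH F N) (w' : WorldP), (θ'.ZhUnity F N ∧ θ'.SlotsNondegenerate₁₃ F N) ∧ θ'.Admissible F N ∧
      IsRecordOfRecord₁₃CCoPH F N (datumOfRecord₁₃CoPH F N θ' h') w' ∧ ∀ P : B12.RunParams, Dag.B10_main (leavesP w' P) :=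
  exists_guarded_record₁₃CCoPH_laneXeOf_b10_main_of_data (suGroupModel M) θ h hθ hG (bump68 𝔠₀) (four_pi_le_regMin_bump68 𝔠₀) (suDir_mem_su hM) (suDir_ne_zero hM)
    X₀ hstd w Bk 𝔖 𝔄 coef hD

/-- **★★ `SU(M)`, `M ≥ 2`: «A CORE-KEYED INHABITATION ⟹ N08's CONJUNCT OF A CORE-KEYED STAGE-13 NODES-∃» FROM THE DATA SCHEMA AT `XeOf` ALONE** — at every odd block size `L > 1`
lane letters `(𝔠₀, X₀ standard, w, Bk, 𝔖, 𝔄, coef)` with the DATA schema at `XeOf` on the window at the bumped constants; NO in-edge face, NO structural hypothesis.  NOT the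
stub, NOT a discharge. [cite: Balaban1985UV3, Thm 1 p.257 (compact reading) + Thm 2 p.272 + p.256 L15–18; Balaban1989LargeFieldII, Thm 1 + (0.1) pp.355–356 (bookkeeping)] -/
theorem exists_guarded_record₁₃CCoPH_laneXeOf_b10_main_of_inhabited13CoPH_su_bump (hM : 2 ≤ M)
    (hI : ∃ θ : Stage13HParams F N, θ.Provisos₁₃CoPH F N ∧ (θ.ZhUnity F N ∧ θ.SlotsNondegenerate₁₃ F N) ∧ θ.Admissible F N)
    (hlane : ∀ L : ℕ, Odd L → 1 < L →
      ∃ (𝔠₀ : AlphaConsts L (suGroupModel M).N) (X₀ : ∀ S : Scales L, ExternalInputs S (Matrix.specialUnitaryGroup (Fin M) ℂ))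
        (hstd : ∀ S : Scales L, (X₀ S).av = AveragingRT.stdAvg S.P (Matrix.specialUnitaryGroup (Fin M) ℂ)) (w : ℝ)
        (Bk : ∀ (S : Scales L) (k : ℕ), Hist S.P k → Set (PBond S.P k))
        (𝔖 : ∀ (S : Scales L) (k : ℕ), StepSeries S (Matrix.specialUnitaryGroup (Fin M) ℂ) ↥(lieC (suGroupModel M)) (nblkOf S (bump68 𝔠₀).lane.carrier k) k)
        (𝔄 : ∀ S : Scales L, AlphaData (suGroupModel M) (bump68 𝔠₀)
          (XeOf (suGroupModel M) (bump68 𝔠₀) X₀ hstd w (suDir_mem_su hM) (suDir_ne_zero hM) (four_pi_le_regMin_bump68 𝔠₀) Bk S) (𝔖 S))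
        (coef : ∀ (S : Scales L) (k : ℕ), Hist S.P (k + 1) → GaugeField S.P (k + 1) (Matrix.specialUnitaryGroup (Fin M) ℂ) → (j : ℕ) → TermSizes (oldGeom S.P k j)),
        ∀ S : Scales L, S.g ^ 2 * S.ε₀ ≤ (min (gammaN08d (bump68 𝔠₀)) 1) ^ 2 →
          RunDataRows (suGroupModel M) (bump68 𝔠₀)
            (XeOf (suGroupModel M) (bump68 𝔠₀) X₀ hstd w (suDir_mem_su hM) (suDir_ne_zero hM) (four_pi_le_regMin_bump68 𝔠₀) Bk S) (𝔖 S) (𝔄 S)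
            (sizesOf (suGroupModel M) (bump68 𝔠₀)
              (XeOf (suGroupModel M) (bump68 𝔠₀) X₀ hstd w (suDir_mem_su hM) (suDir_ne_zero hM) (four_pi_le_regMin_bump68 𝔠₀) Bk S) (coef S))) :
    ∃ (θ : Stage13HParams F N) (h : θ.Provisos₁₃CoPH F N) (w' : WorldP), (θ.ZhUnity F N ∧ θ.SlotsNondegenerate₁₃ F N) ∧ θ.Admissible F N ∧
      IsRecordOfRecord₁₃CCoPH F N (datumOfRecord₁₃CoPH F N θ h) w' ∧ ∀ P : B12.RunParams, Dag.B10_main (leavesP w' P) := by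
  obtain ⟨θ, h, hG, hθ⟩ := hI
  obtain ⟨𝔠₀, X₀, hstd, w, Bk, 𝔖, 𝔄, coef, hD⟩ := hlane θ.L θ.hL.1 θ.hL.2
  exact exists_guarded_record₁₃CCoPH_laneXeOf_b10_main_of_data_su_bump hM θ h hθ hG 𝔠₀ X₀ hstd w Bk 𝔖 𝔄 coef hD

/-- **★★ THE SAME AT THE GROUPS OF RECORD: the T⁴ side at `N = 2`** (hypothesis `hI` = the Core-keyed inhabitation text at `F 2`) **and the lane at `SU(2)`** (`M = 2`).
[cite: Balaban1985UV3, Thm 1 p.257 (compact reading) + Thm 2 p.272; Balaban1989LargeFieldII, Thm 1 + (0.1) pp.355–356 (bookkeeping)] -/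
theorem exists_guarded_record₁₃CCoPH_laneXeOf_b10_main_of_inhabited13CoPH_su_bump_two (F : T4Family)
    (hI : ∃ θ : Stage13HParams F 2, θ.Provisos₁₃CoPH F 2 ∧ (θ.ZhUnity F 2 ∧ θ.SlotsNondegenerate₁₃ F 2) ∧ θ.Admissible F 2)
    (hlane : ∀ L : ℕ, Odd L → 1 < L →
      ∃ (𝔠₀ : AlphaConsts L (suGroupModel 2).N) (X₀ : ∀ S : Scales L, ExternalInputs S (Matrix.specialUnitaryGroup (Fin 2) ℂ))
        (hstd : ∀ S : Scales L, (X₀ S).av = AveragingRT.stdAvg S.P (Matrix.specialUnitaryGroup (Fin 2) ℂ)) (w : ℝ)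
        (Bk : ∀ (S : Scales L) (k : ℕ), Hist S.P k → Set (PBond S.P k))
        (𝔖 : ∀ (S : Scales L) (k : ℕ), StepSeries S (Matrix.specialUnitaryGroup (Fin 2) ℂ) ↥(lieC (suGroupModel 2)) (nblkOf S (bump68 𝔠₀).lane.carrier k) k)
        (𝔄 : ∀ S : Scales L, AlphaData (suGroupModel 2) (bump68 𝔠₀)
          (XeOf (suGroupModel 2) (bump68 𝔠₀) X₀ hstd w (suDir_mem_su le_rfl) (suDir_ne_zero le_rfl) (four_pi_le_regMin_bump68 𝔠₀) Bk S) (𝔖 S))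
        (coef : ∀ (S : Scales L) (k : ℕ), Hist S.P (k + 1) → GaugeField S.P (k + 1) (Matrix.specialUnitaryGroup (Fin 2) ℂ) → (j : ℕ) → TermSizes (oldGeom S.P k j)),
        ∀ S : Scales L, S.g ^ 2 * S.ε₀ ≤ (min (gammaN08d (bump68 𝔠₀)) 1) ^ 2 →
          RunDataRows (suGroupModel 2) (bump68 𝔠₀)
            (XeOf (suGroupModel 2) (bump68 𝔠₀) X₀ hstd w (suDir_mem_su le_rfl) (suDir_ne_zero le_rfl) (four_pi_le_regMin_bump68 𝔠₀) Bk S) (𝔖 S) (𝔄 S)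
            (sizesOf (suGroupModel 2) (bump68 𝔠₀)
              (XeOf (suGroupModel 2) (bump68 𝔠₀) X₀ hstd w (suDir_mem_su le_rfl) (suDir_ne_zero le_rfl) (four_pi_le_regMin_bump68 𝔠₀) Bk S) (coef S))) :
    ∃ (θ : Stage13HParams F 2) (h : θ.Provisos₁₃CoPH F 2) (w' : WorldP), (θ.ZhUnity F 2 ∧ θ.SlotsNondegenerate₁₃ F 2) ∧ θ.Admissible F 2 ∧
      IsRecordOfRecord₁₃CCoPH F 2 (datumOfRecord₁₃CoPH F 2 θ h) w' ∧ ∀ P : B12.RunParams, Dag.B10_main (leavesP w' P) :=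
  exists_guarded_record₁₃CCoPH_laneXeOf_b10_main_of_inhabited13CoPH_su_bump le_rfl hI hlane

end SU

/-! ## §3 ON K0a's ALL-NUMERICS WITNESS FAMILY `θL F n ε₂₉ = theta13LiveOfNumerics F 2 n ε₂₉ …` (block size `F.L` by `rfl`), CORE PROVISOS OPAQUE, lane `SU(2)` at `bump68 𝔠₀` -/

section Numerics

/-- **★★ N08's CONJUNCT OF A CORE-KEYED ₁₃ NODES-∃ AT `N = 2`, WITNESSED AT THE MEMBER `θL F n ε₂₉`, FROM THE DATA SCHEMA AT `XeOf` ALONE** (lane `SU(2)`, constants `bump68 𝔠₀`,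
block size `F.L`): from `n.Pos`, `0 < ε₂₉`, the member's Core provisos `hP` (HYPOTHESIS, opaque), base inputs `X₀` (standard averaging), `w`, `Bk`, data `𝔖 ∕ 𝔄 ∕ coef` and
`RunDataRows` at `XeOf` on the window — guard and admissibility at `θL` are K0a's theorems BY NAME (HYPOTHESIS-FREE row P12). [cite: Balaban1985UV3, Thm 1 p.257 (compact reading) + Thm 2 p.272; Balaban1988Convergent, (3.16)–(3.22) pp.268–269; Balaban1987RG1, Thm 1 p.255 (bookkeeping)] -/
theorem exists_guarded_record₁₃CCoPH_laneXeOf_b10_main_at_theta13LiveOfNumerics_of_data_su_bump (F : T4Family) (Zr : (p : B12.RunParams) → TkResidualW F 2 (FluctV 2) p.K)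
    (Zh : (p : B12.RunParams) → ℕ → (ℕ → Set (Site (F.P p.K) 0)) → (ℕ → Set (Site (F.P p.K) 0)) → TkResidualW F 2 (FluctV 2) p.K)
    (Phih : (p : B12.RunParams) → ℕ → (ℕ → Set (Site (F.P p.K) 0)) → (ℕ → Set (Site (F.P p.K) 0)) → (ℕ → Plaq (F.P p.K) 0 → ℝ)) {n : Stage12Numerics} {ε₂₉ : ℝ} (hn : n.Pos)
    (hε' : 0 < ε₂₉) (hP : (⟨⟨theta13LiveOfNumerics F 2 n ε₂₉ (zeta316OfRecord F 2 n.ν n.τ9.M n.A₁) (RzOfRecord F 2) (ZtOfRecord F 2), Zr⟩, Zh, Phih⟩ : Stage13HParams F 2).Provisos₁₃CoPH F 2)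
    (hZ : (⟨⟨theta13LiveOfNumerics F 2 n ε₂₉ (zeta316OfRecord F 2 n.ν n.τ9.M n.A₁) (RzOfRecord F 2) (ZtOfRecord F 2), Zr⟩, Zh, Phih⟩ : Stage13HParams F 2).ZhUnity F 2)
    (𝔠₀ : AlphaConsts F.L (suGroupModel 2).N) (X₀ : ∀ S : Scales F.L, ExternalInputs S (Matrix.specialUnitaryGroup (Fin 2) ℂ))
    (hstd : ∀ S : Scales F.L, (X₀ S).av = AveragingRT.stdAvg S.P (Matrix.specialUnitaryGroup (Fin 2) ℂ)) (w : ℝ)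
    (Bk : ∀ (S : Scales F.L) (k : ℕ), Hist S.P k → Set (PBond S.P k))
    (𝔖 : ∀ (S : Scales F.L) (k : ℕ), StepSeries S (Matrix.specialUnitaryGroup (Fin 2) ℂ) ↥(lieC (suGroupModel 2)) (nblkOf S (bump68 𝔠₀).lane.carrier k) k)
    (𝔄 : ∀ S : Scales F.L, AlphaData (suGroupModel 2) (bump68 𝔠₀)
      (XeOf (suGroupModel 2) (bump68 𝔠₀) X₀ hstd w (suDir_mem_su le_rfl) (suDir_ne_zero le_rfl) (four_pi_le_regMin_bump68 𝔠₀) Bk S) (𝔖 S))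
    (coef : ∀ (S : Scales F.L) (k : ℕ), Hist S.P (k + 1) → GaugeField S.P (k + 1) (Matrix.specialUnitaryGroup (Fin 2) ℂ) → (j : ℕ) → TermSizes (oldGeom S.P k j))
    (hD : ∀ S : Scales F.L, S.g ^ 2 * S.ε₀ ≤ (min (gammaN08d (bump68 𝔠₀)) 1) ^ 2 →
      RunDataRows (suGroupModel 2) (bump68 𝔠₀)
        (XeOf (suGroupModel 2) (bump68 𝔠₀) X₀ hstd w (suDir_mem_su le_rfl) (suDir_ne_zero le_rfl) (four_pi_le_regMin_bump68 𝔠₀) Bk S) (𝔖 S) (𝔄 S)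
        (sizesOf (suGroupModel 2) (bump68 𝔠₀)
          (XeOf (suGroupModel 2) (bump68 𝔠₀) X₀ hstd w (suDir_mem_su le_rfl) (suDir_ne_zero le_rfl) (four_pi_le_regMin_bump68 𝔠₀) Bk S) (coef S))) :
    ∃ (θ : Stage13HParams F 2) (h : θ.Provisos₁₃CoPH F 2) (w' : WorldP), (θ.ZhUnity F 2 ∧ θ.SlotsNondegenerate₁₃ F 2) ∧ θ.Admissible F 2 ∧
      IsRecordOfRecord₁₃CCoPH F 2 (datumOfRecord₁₃CoPH F 2 θ h) w' ∧ ∀ P : B12.RunParams, Dag.B10_main (leavesP w' P) :=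
  exists_guarded_record₁₃CCoPH_laneXeOf_b10_main_of_data_su_bump le_rfl _ hP (admissible_theta13LiveOfNumerics F 2 _ _ _ hn hε')
    ⟨hZ, slotsNondegenerate₁₃_theta13LiveOfNumerics_of_hasResiduals F 2 n ε₂₉⟩ 𝔠₀ X₀ hstd w Bk 𝔖 𝔄 coef hD

end Numerics

end Summit.QuantumFields.YangMills.BalabanUVNodes.N08AtRecord13CoPHLaneXeOf

end
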